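import Summits.BirchSwinnertonDyer.BirchSwinnertonDyer.Theorems.PrintCf2RubinValueTwoRestrictedMainConjLinePush
import Summits.BirchSwinnertonDyer.BirchSwinnertonDyer.Theorems.PrintCf2SplitBadTwoRestrictedSelmerKernelFinite
import HarnessLib

/-!
# Route C `PrintCf2RubinValueTwo`, crux `RestrictedMainConjWithValueAtTwo` (stmt-BirchSwinnertonDyer-23722), stub `stub_restrictedEven` —
# the «PUSH» to the line, Selmer side, ON THE FRAMES: `W*(K̃_∞)` is FINITE (additive place above `7`), hence the control map
# `𝔖_v̄(K*_∞, W*) → H¹_nr(K̃_∞, W*)` and the transpose `D₂.X → D.X` have FINITE kernel / cokernel on every member, unconditionally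

Cell `bsd-print-cf2`, width seat `bsd-line-cf2c-w8` g0 (prover-bsd-line-cf2c-w8-g0-0); `--supports stmt-BirchSwinnertonDyer-23722`. Sequel of
`…RestrictedMainConjLinePush` (p682128: generic control map `lineRes`, kernel `# ≤ #(M^{Gal(K̄/K̃_∞)}/(γ₂ − 1))`, transpose `φ` with
`#coker φ ≤ #ker lineRes`). HONEST FRAMING: nothing here closes the crux or the registered stub; BSD is not proved by any of this; no summit
statement is proved by this seat. No definition, no named fact, no `sorry`. UNCONDITIONAL.

WHAT. The side condition of p682128 §3 is `Finite (M^{Gal(K̄/K̃_∞)} ⧸ (γ₂ − 1))`. On road α it holds in the strongest form: the whole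
fixed module `W*(K̃_∞) := (W*)^{pairKer κ' κ₂}` is FINITE, for the same reason the LEAD's p65x `finite_fixedPoints_kerSubgroup_of_frame` gave
`W*(K*_∞)` finite (`…RestrictedSelmerKernelFinite`): the place `w ∣ 7` of `K` is ADDITIVE for `W_K` (`j = −3375`,
`…SplitBadTwoAdditiveAtSeven`), prime to `2`, and unramified in BOTH lines — `κ'` unramified outside `v̄`, `κ₂` unramified outside `v` —
so `I_w ≤ ker κ' ⊓ ker κ₂ = pairKer κ' κ₂ = Gal(K̄/K̃_∞)`, and the `I_w`-fixed `2`-power torsion is killed by one integer (Silverman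
*ATAEC* IV.10.2(a), tree `exists_nsmul_eq_zero_of_absInertia_fixed_of_hasAdditiveReductionAt`).
* §1 (generic, any `K`, `p`, elliptic `E/K`, summand `↥(E.endEigenPrimaryTorsion p π r)`): `I_w ≤ pairKer κ₁ κ₂` for `κ_i` unramified
  outside `𝔮_i ≠ w`; **`finite_fixedPoints_pairKer_…_of_hasAdditiveReductionAt`** — `E[p^∞]^{Gal(K̄/K̃_∞)}` and its summands are finite when
  `E` is additive at such a `w ∤ p`.
* §2 (road α frames: member `C • W = cm7^{(d)}`, `K` imaginary quadratic, `v ≠ v̄` over `2`, ANY `π, r`, `κ'` unramified outside `v̄`,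
  `κ₂` unramified outside `v`): **`finite_fixedPoints_pairKer_of_frame`** — `W*(K̃_∞)` is finite; hence (p682128 §3, §4) for every generator
  pair `(κ', κ₂; γ', γ₂)`: **`finite_ker_lineRes_of_frame`** (`#ker lineRes ≤ #W*(K̃_∞)`), **`exists_transpose_of_frame`** (the `π`-semilinear
  transpose for ANY `D₂ : DualData₂ κ' κ₂ W* v̄ γ' γ₂`, `D : RestrictedDualData κ' W* v̄ γ'`, with `#coker ≤ #W*(K̃_∞)`).
So on every member the exact sequence `D₂.X ⧸ T₂ → D.X → (finite) → 0` of the push holds with no hypothesis left on the kernel side; the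
image side (exact control: `im lineRes` vs `H¹_nr(K̃_∞, W*)^{γ₂ = 1}`, local at `v̄` and away from `2`) is the remaining Selmer-side input.
presearch: Agboola 2007 §3 Prop. 3.2 / §4 (arXiv:math/0602192), Greenberg LNM 1716 Lemma 3.1, Silverman ATAEC IV.10.2(a) — all held; assembly
of tree theorems, no new fact. beyond-print theorem: no.

References: [Agboola2007] §3 Prop. 3.2, §4; [GreenbergLNM1716] §3 Lemma 3.1; [SilvermanATAEC1994] Thm. IV.10.2(a); [Rubin1991] §4.
-/

noncomputable section

open scoped Classical
-- the summit namespace `Summit.BirchSwinnertonDyer.BirchSwinnertonDyer` repeats the problem name by design (D-0017)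
set_option linter.dupNamespace false
set_option autoImplicit false

open NumberField IsDedekindDomain Field WeierstrassCurve
open Literature.NumberTheory.EllipticCurves Literature.NumberTheory.EllipticCurves.GreenbergSelmer
open Literature.NumberTheory.EllipticCurves.Agboola2007
open Literature.NumberTheory.EllipticCurves.IwasawaDual
open Literature.NumberTheory.EllipticCurves.ResKernel
open Literature.NumberTheory.GaloisRepresentations
open Summit.BirchSwinnertonDyer.BirchSwinnertonDyer.Theorems.PrintCf2.RestrictedSelmerPair

universe u

namespace Summit.BirchSwinnertonDyer.BirchSwinnertonDyer.Theorems.PrintCf2.LinePush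

/-! ## §1. `E[p^∞]^{Gal(K̄/K̃_∞)}` is finite when both lines are unramified at an additive place `w ∤ p` -/

section Generic

variable {K : Type u} [Field K] [NumberField K] {p : ℕ} [Fact p.Prime]

/-- **Inertia at a place where both lines are unramified lies in `Gal(K̄/K̃_∞)`**: for `κ₁` unramified outside `𝔮₁`, `κ₂` unramified
outside `𝔮₂` and `w ≠ 𝔮₁, 𝔮₂`, every local inertia element at `w` (through `res : Γ_{K_w} → Γ_K`) lies in `pairKer κ₁ κ₂` and hence
fixes every `m ∈ M^{Gal(K̄/K̃_∞)}`. [cite: Agboola2007, §1 p. 1 (arXiv p0003:L9–11)] -/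
theorem smul_eq_self_of_mem_absInertia_of_isUnramifiedOutside_pair (κ₁ κ₂ : ZpExtension K p)
    {𝔮₁ 𝔮₂ w : HeightOneSpectrum (𝓞 K)} (hκ₁ : κ₁.IsUnramifiedOutside 𝔮₁) (hκ₂ : κ₂.IsUnramifiedOutside 𝔮₂)
    (hw₁ : w ≠ 𝔮₁) (hw₂ : w ≠ 𝔮₂) {M : Type u} [AddCommGroup M] [DistribMulAction (absoluteGaloisGroup K) M]
    {m : M} (hm : m ∈ FixedPoints.addSubgroup (ZpExtension.pairKer κ₁ κ₂) M)
    {σ : absoluteGaloisGroup (w.adicCompletion K)} (hσ : σ ∈ absInertia (w.adicCompletion K)) :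
    absGaloisRestrict K (w.adicCompletion K) σ • m = m := by
  have hmem : absGaloisRestrict K (w.adicCompletion K) σ ∈ ZpExtension.pairKer κ₁ κ₂ :=
    Subgroup.mem_inf.mpr ⟨hκ₁ w hw₁ (Subgroup.mem_map.mpr ⟨σ, hσ, rfl⟩), hκ₂ w hw₂ (Subgroup.mem_map.mpr ⟨σ, hσ, rfl⟩)⟩
  exact hm ⟨_, hmem⟩

/-- **`E[p^∞]^{Gal(K̄/K̃_∞)}` is finite** when the two lines `κ₁`, `κ₂` are unramified outside `𝔮₁`, `𝔮₂` and `E/K` has ADDITIVE reduction at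
a finite place `w ≠ 𝔮₁, 𝔮₂`, `w ∤ p`: `I_w ≤ pairKer κ₁ κ₂` and the `I_w`-fixed `p`-power torsion is killed by one `c ≠ 0` (Silverman
*ATAEC* IV.10.2(a), additive case), so `E[p^∞]^{Gal(K̄/K̃_∞)} ↪ E[c]`. The two-line twin of the LEAD's
`finite_fixedPoints_kerSubgroup_geomPrimaryTorsion_of_hasAdditiveReductionAt`. [cite: SilvermanATAEC1994, Thm. IV.10.2(a)]
[cite: Agboola2007, §3 Prop. 3.2] -/
theorem finite_fixedPoints_pairKer_geomPrimaryTorsion_of_hasAdditiveReductionAt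
    (W : WeierstrassCurve K) [W.IsElliptic] (κ₁ κ₂ : ZpExtension K p) {𝔮₁ 𝔮₂ w : HeightOneSpectrum (𝓞 K)}
    (hκ₁ : κ₁.IsUnramifiedOutside 𝔮₁) (hκ₂ : κ₂.IsUnramifiedOutside 𝔮₂) (hw₁ : w ≠ 𝔮₁) (hw₂ : w ≠ 𝔮₂)
    (hwp : ((p : ℕ) : 𝓞 K) ∉ w.asIdeal) (hadd : W.HasAdditiveReductionAt w) :
    Finite (FixedPoints.addSubgroup (ZpExtension.pairKer κ₁ κ₂) (W.geomPrimaryTorsion p)) := by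
  obtain ⟨c, hc, hkill⟩ := W.exists_nsmul_eq_zero_of_absInertia_fixed_of_hasAdditiveReductionAt p hwp hadd
  haveI : Finite (geomTorsion W (c : ℤ)) := W.finite_geomTorsion_natCast hc
  let f : FixedPoints.addSubgroup (ZpExtension.pairKer κ₁ κ₂) (W.geomPrimaryTorsion p) → geomTorsion W (c : ℤ) :=
    fun x ↦ ⟨((x : W.geomPrimaryTorsion p) : geomPoints W), by
      rw [W.mem_geomTorsion_iff, natCast_zsmul]
      obtain ⟨n, hn⟩ := (AddCommGroup.mem_primaryComponent).mp (x : W.geomPrimaryTorsion p).2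
      refine hkill _ (fun σ hσ ↦ ?_) n hn
      have h := smul_eq_self_of_mem_absInertia_of_isUnramifiedOutside_pair κ₁ κ₂ hκ₁ hκ₂ hw₁ hw₂ x.2 hσ
      have h' := congrArg (fun y : W.geomPrimaryTorsion p ↦ (y : geomPoints W)) h
      simpa only [primaryComponent.coe_smul] using h'⟩
  have hf : Function.Injective f := fun a b hab ↦ by
    have h1 := congrArg Subtype.val hab
    exact Subtype.ext (Subtype.ext h1)
  exact Finite.of_injective f hf

/-- **The CM-summand form**: for ANY `K`-rational endomorphism `π` and `r ∈ ℤ_p`, `(↥(W.endEigenPrimaryTorsion p π r))^{Gal(K̄/K̃_∞)}` is finite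
under the same hypotheses (it embeds into `E[p^∞]^{Gal(K̄/K̃_∞)}`). [cite: Agboola2007, §3 Prop. 3.2 (`W*(K*_∞)`)]
[cite: SilvermanATAEC1994, Thm. IV.10.2(a)] -/
theorem finite_fixedPoints_pairKer_endEigenPrimaryTorsion_of_hasAdditiveReductionAt
    (W : WeierstrassCurve K) [W.IsElliptic] (π : W.endRing) (r : ℤ_[p]) (κ₁ κ₂ : ZpExtension K p)
    {𝔮₁ 𝔮₂ w : HeightOneSpectrum (𝓞 K)} (hκ₁ : κ₁.IsUnramifiedOutside 𝔮₁) (hκ₂ : κ₂.IsUnramifiedOutside 𝔮₂)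
    (hw₁ : w ≠ 𝔮₁) (hw₂ : w ≠ 𝔮₂) (hwp : ((p : ℕ) : 𝓞 K) ∉ w.asIdeal) (hadd : W.HasAdditiveReductionAt w) :
    Finite (FixedPoints.addSubgroup (ZpExtension.pairKer κ₁ κ₂) ↥(W.endEigenPrimaryTorsion p π r)) := by
  haveI := finite_fixedPoints_pairKer_geomPrimaryTorsion_of_hasAdditiveReductionAt W κ₁ κ₂ hκ₁ hκ₂ hw₁ hw₂ hwp hadd
  let f : FixedPoints.addSubgroup (ZpExtension.pairKer κ₁ κ₂) ↥(W.endEigenPrimaryTorsion p π r) →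
      FixedPoints.addSubgroup (ZpExtension.pairKer κ₁ κ₂) (W.geomPrimaryTorsion p) :=
    fun x ↦ ⟨((x : ↥(W.endEigenPrimaryTorsion p π r)) : W.geomPrimaryTorsion p), fun τ ↦ by
      have h := x.2 τ
      exact congrArg Subtype.val h⟩
  have hf : Function.Injective f := fun a b hab ↦ by
    have h1 := congrArg Subtype.val hab
    exact Subtype.ext (Subtype.ext h1)
  exact Finite.of_injective f hf

end Generic

/-! ## §2. Road α: `W*(K̃_∞)` is finite on every frame; the control kernel and the transpose cokernel are finite -/

section Frame

open Summit.BirchSwinnertonDyer.BirchSwinnertonDyer.Theorems.PrintCf2.AdditiveAtSeven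

variable {K : Type} [Field K] [NumberField K]

/-- **`W*(K̃_∞)` IS FINITE on every frame**: member `C • W = cm7^{(d)}`, `K` imaginary quadratic, `v`, `v̄` over `2`, ANY `π, r`, `κ'`
unramified outside `v̄`, `κ₂` unramified outside `v`: the `Gal(K̄/K̃_∞) = pairKer κ' κ₂`-fixed part of
`W* = ↥((W.baseChange K).endEigenPrimaryTorsion 2 π r)` is finite — the place above `7` is additive for `W_K` (`j = −3375`), prime to `2`,
and unramified in both lines. [cite: Agboola2007, §3 Prop. 3.2 (arXiv p0008:L128–135)] [cite: SilvermanATAEC1994, Thm. IV.10.2(a)] -/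
theorem finite_fixedPoints_pairKer_of_frame {d : ℤ} (hd0 : d ≠ 0) (W : WeierstrassCurve ℚ) [W.IsElliptic]
    (C : VariableChange ℚ) (hC : C • W = cm7.quadraticTwist (d : ℚ)) (hK : IsImaginaryQuadratic K)
    (v vbar : HeightOneSpectrum (𝓞 K)) (hv : ((2 : ℕ) : 𝓞 K) ∈ v.asIdeal) (hvbar : ((2 : ℕ) : 𝓞 K) ∈ vbar.asIdeal)
    (π : (W.baseChange K).endRing) (r : ℤ_[2]) (κ' κ₂ : ZpExtension K 2) (hκ' : κ'.IsUnramifiedOutside vbar)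
    (hκ₂ : κ₂.IsUnramifiedOutside v) :
    Finite (FixedPoints.addSubgroup (ZpExtension.pairKer κ' κ₂) ↥((W.baseChange K).endEigenPrimaryTorsion 2 π r)) := by
  obtain ⟨w, h7⟩ := exists_heightOneSpectrum_natCast_mem (K := K) (q := 7) (by norm_num)
  have h2w : ((2 : ℕ) : 𝓞 K) ∉ w.asIdeal := natCast_two_notMem_of_seven_mem w h7
  have hw₁ : w ≠ vbar := fun h ↦ h2w (h ▸ hvbar)
  have hw₂ : w ≠ v := fun h ↦ h2w (h ▸ hv)
  haveI : (W.baseChange K).IsElliptic := by rw [baseChange]; infer_instance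
  exact finite_fixedPoints_pairKer_endEigenPrimaryTorsion_of_hasAdditiveReductionAt (W.baseChange K) π r κ' κ₂ hκ' hκ₂ hw₁ hw₂
    h2w (hasAdditiveReductionAt_baseChange_of_j_eq_cm7_of_finrank_eq_two K w hK.1 W (j_eq_of_smul_eq_cm7Twist hd0 W C hC) h7)

/-- **THE KERNEL OF CONTROL `𝔖_v̄(K*_∞, W*) → H¹_nr(K̃_∞, W*)` IS FINITE ON EVERY FRAME, `# ≤ #W*(K̃_∞)`**: for every generator pair
`(κ', κ₂; γ', γ₂)` of the two lines (`κ'` unramified outside `v̄`, `κ₂` unramified outside `v`) and the control map `g` of p682128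
(`exists_lineRes`): `ker g` is finite with `#ker g ≤ #(W*^{pairKer} ⧸ (γ₂ − 1)) ≤ #W*(K̃_∞)` — p682128 §3 with its side condition discharged
by `finite_fixedPoints_pairKer_of_frame`. Agboola's Prop. 3.2 kernel in the tower direction at the additive prime.
[cite: Agboola2007, §3 Prop. 3.2 and §4] [cite: GreenbergLNM1716, §3 Lemma 3.1] -/
theorem finite_ker_lineRes_of_frame {d : ℤ} (hd0 : d ≠ 0) (W : WeierstrassCurve ℚ) [W.IsElliptic]
    (C : VariableChange ℚ) (hC : C • W = cm7.quadraticTwist (d : ℚ)) (hK : IsImaginaryQuadratic K)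
    (v vbar : HeightOneSpectrum (𝓞 K)) (hv : ((2 : ℕ) : 𝓞 K) ∈ v.asIdeal) (hvbar : ((2 : ℕ) : 𝓞 K) ∈ vbar.asIdeal)
    (π : (W.baseChange K).endRing) (r : ℤ_[2]) (κ' κ₂ : ZpExtension K 2) (hκ' : κ'.IsUnramifiedOutside vbar)
    (hκ₂ : κ₂.IsUnramifiedOutside v) {γ' γ₂ : absoluteGaloisGroup K} (hγ : ZpExtension.IsTopGeneratorPair κ' κ₂ γ' γ₂)
    {g : restrictedSelmerZp κ' ↥((W.baseChange K).endEigenPrimaryTorsion 2 π r) vbar →+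
      unrSelmer₂ κ' κ₂ ↥((W.baseChange K).endEigenPrimaryTorsion 2 π r) vbar}
    (hg : ∀ t, ((g t : unrSelmer₂ κ' κ₂ ↥((W.baseChange K).endEigenPrimaryTorsion 2 π r) vbar) :
        subgroupH1 (ZpExtension.pairKer κ' κ₂) ↥((W.baseChange K).endEigenPrimaryTorsion 2 π r)) =
      resOfLe ↥((W.baseChange K).endEigenPrimaryTorsion 2 π r) (ZpExtension.pairKer_le_left κ' κ₂)
        (t : subgroupH1 κ'.kerSubgroup ↥((W.baseChange K).endEigenPrimaryTorsion 2 π r))) :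
    Finite g.ker ∧ Nat.card g.ker ≤
      Nat.card (FixedPoints.addSubgroup (ZpExtension.pairKer κ' κ₂) ↥((W.baseChange K).endEigenPrimaryTorsion 2 π r)) := by
  set M := ↥((W.baseChange K).endEigenPrimaryTorsion 2 π r)
  haveI hF := finite_fixedPoints_pairKer_of_frame hd0 W C hC hK v vbar hv hvbar π r κ' κ₂ hκ' hκ₂
  haveI : Finite (FixedPoints.addSubgroup (ZpExtension.pairKer κ' κ₂) M ⧸ (subOne (ZpExtension.pairKer κ' κ₂) M γ₂).range) :=
    inferInstance
  obtain ⟨hfin, hle⟩ := finite_ker_lineRes_and_card_le hg hγ (continuous_smul_endEigenPrimaryTorsion (W.baseChange K) 2 π r)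
  exact ⟨hfin, hle.trans (natCard_quotient_le _)⟩

/-- **THE TRANSPOSE ON EVERY FRAME**: for every generator pair `(κ', κ₂; γ', γ₂)` as above, EVERY `Λ₂`-dual datum `D₂` of
`H¹_nr(K̃_∞, W*)` and EVERY Agboola dual datum `D` of `𝔖_v̄(K*_∞, W*)`, there is a `π`-semilinear `φ : D₂.X →ₛₗ[π] D.X`
(`π = PowerSeries.map constantCoeff`, `T₂ ↦ 0`), transpose of the control map `g`, whose cokernel is FINITE with `# ≤ #W*(K̃_∞)` —
p682128 §4 with `htor`/`hstab` (`W*` is `2`-primary with open stabilisers) and the kernel finiteness discharged on the frame.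
[cite: Agboola2007, §4 (arXiv p0010)] [cite: GreenbergLNM1716, §1 p. 60, §3 Lemma 3.1] -/
theorem exists_transpose_of_frame {d : ℤ} (hd0 : d ≠ 0) (W : WeierstrassCurve ℚ) [W.IsElliptic]
    (C : VariableChange ℚ) (hC : C • W = cm7.quadraticTwist (d : ℚ)) (hK : IsImaginaryQuadratic K)
    (v vbar : HeightOneSpectrum (𝓞 K)) (hv : ((2 : ℕ) : 𝓞 K) ∈ v.asIdeal) (hvbar : ((2 : ℕ) : 𝓞 K) ∈ vbar.asIdeal)
    (π : (W.baseChange K).endRing) (r : ℤ_[2]) (κ' κ₂ : ZpExtension K 2) (hκ' : κ'.IsUnramifiedOutside vbar)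
    (hκ₂ : κ₂.IsUnramifiedOutside v) {γ' γ₂ : absoluteGaloisGroup K} (hγ : ZpExtension.IsTopGeneratorPair κ' κ₂ γ' γ₂)
    {g : restrictedSelmerZp κ' ↥((W.baseChange K).endEigenPrimaryTorsion 2 π r) vbar →+
      unrSelmer₂ κ' κ₂ ↥((W.baseChange K).endEigenPrimaryTorsion 2 π r) vbar}
    (hg : ∀ t, ((g t : unrSelmer₂ κ' κ₂ ↥((W.baseChange K).endEigenPrimaryTorsion 2 π r) vbar) :
        subgroupH1 (ZpExtension.pairKer κ' κ₂) ↥((W.baseChange K).endEigenPrimaryTorsion 2 π r)) =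
      resOfLe ↥((W.baseChange K).endEigenPrimaryTorsion 2 π r) (ZpExtension.pairKer_le_left κ' κ₂)
        (t : subgroupH1 κ'.kerSubgroup ↥((W.baseChange K).endEigenPrimaryTorsion 2 π r)))
    (D₂ : DualData₂ κ' κ₂ ↥((W.baseChange K).endEigenPrimaryTorsion 2 π r) vbar γ' γ₂)
    (D : RestrictedDualData κ' ↥((W.baseChange K).endEigenPrimaryTorsion 2 π r) vbar γ') :
    ∃ φ : D₂.X →ₛₗ[(PowerSeries.map (PowerSeries.constantCoeff (R := ℤ_[2])) : IwasawaAlgebra₂ 2 →+* IwasawaAlgebra 2)] D.X,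
      (∀ (x : D₂.X) (t : restrictedSelmerZp κ' ↥((W.baseChange K).endEigenPrimaryTorsion 2 π r) vbar),
          D.toDual (φ x) t = D₂.toDual x (g t)) ∧
        Finite (D.X ⧸ φ.toAddMonoidHom.range) ∧
          Nat.card (D.X ⧸ φ.toAddMonoidHom.range) ≤
            Nat.card (FixedPoints.addSubgroup (ZpExtension.pairKer κ' κ₂) ↥((W.baseChange K).endEigenPrimaryTorsion 2 π r)) := by
  have htor : ∀ m : ↥((W.baseChange K).endEigenPrimaryTorsion 2 π r), ∃ k : ℕ, 2 ^ k • m = 0 :=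
    exists_pow_smul_endEigenPrimaryTorsion_eq_zero (W.baseChange K) 2 π r
  have hstab : ∀ m : ↥((W.baseChange K).endEigenPrimaryTorsion 2 π r),
      IsOpen (MulAction.stabilizer (absoluteGaloisGroup K) m : Set (absoluteGaloisGroup K)) :=
    isOpen_stabilizer_endEigenPrimaryTorsion (W.baseChange K) 2 π r
  obtain ⟨φ, hφ⟩ := exists_transpose hg hγ htor hstab D₂ D
  obtain ⟨hfin, hle⟩ := finite_ker_lineRes_of_frame hd0 W C hC hK v vbar hv hvbar π r κ' κ₂ hκ' hκ₂ hγ hg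
  haveI : Finite g.ker := hfin
  have hC' := finite_coker_transpose_and_card_le hg hφ
  refine ⟨φ, hφ, hC'.1, ?_⟩
  exact le_trans hC'.2 hle

end Frame

end Summit.BirchSwinnertonDyer.BirchSwinnertonDyer.Theorems.PrintCf2.LinePush
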